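import Summits.QuantumFields.YangMills.Theorems.BalabanUVNodesN08AlphaEq324RowCumLetter
import Summits.QuantumFields.YangMills.Theorems.BalabanUVNodesN08ConstructedCoreLT

/-!
# Route «BalabanUVNodes», Track-A DAG node N08 = [Balaban1985UV3] Thm 1 p. 257 ∕ Thm 2 p. 272 — THE LANE'S END THEOREMS AND N08 BY NAME FROM THE (α) CLAUSE
# AT AN ARBITRARY CUMULANT LETTER (`…RowCumLetter.RunAlphaEq324CoreLTAt 𝔄 c`)

Cell `pub-ymgap`, seat `pub-ymgap-dag-n08-w4` gen 2 (INTENT-2; sequel of `…N08AlphaEq324RowCumLetter`).  `bears_on: R4∕N08`; filed `--supports stmt-QuantumFields-20542`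
(K1⁷).  THEOREMS ONLY (def-free, sorry-free, standard axioms); gen 0's `…RowRange` ∕ `…N08ConstructedCoreLT`, dag-n08-a's T4 and the lane consumed BY NAME.

WHAT IS PROVED — gen 0's `…RowRange` §3 and `…N08ConstructedCoreLT` with `StepAlphaEq324CoreLT ↦ StepAlphaEq324CoreLTAt … c` (the (3.24) row and the G3D-02 row
reading an ARBITRARY cumulant function `c k h U : ℕ → ℝ` — e.g. the FREE Gaussian moment-cumulants of the [2]-road instead of the lane's χ-weighted `(𝔖 k).cum`):
* §1 `stepResiduals_of_coreLTAt_of_thresholds` — the residual step leaves from the re-lettered core step list, given the (28)-smallness and the `γ_OO` threshold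
  (rows C3∕C4 by `…RowCumLetter.cumulant58∕cumulantLower_pieces_of_eq324_at`, everything else verbatim); `runResiduals_of_alphaEq324CoreLTAt` (exhibited family),
  `runResiduals_of_alphaEq324CoreLTAt_le` (`≤`-family).
* §2 ★ `uvStability3D_of_inputsEq324CoreLTAt` ∕ ★ `uvStability3D_of_inputsEq324CoreLTAt_le` — Bałaban CMP 102 Theorem 1 (compact reading) ∧ Theorem 2 for the lane's
  CONSTRUCTED densities from the re-lettered clause, for EVERY letter `c`.
* §3 `nonempty_concreteLeaves_of_coreLTAt_le` and ★ `b10_main_of_coreLTAt_upC` — N08 BY NAME (`Dag.B10_main (leavesP w P) ∧ b10Compact …`) at the C-binding of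
  record over the constructed run family on `ScalesLE L ((min γ₀ 1)²)`, from the re-lettered clause (gen 0's abstracted closers `…N08ConstructedCoreLT.
  b10_main_constructedLE_upC_of_concreteLeaves` ∕ `b10Compact_constructedLE_of_concreteLeaves` fed with the new bundles).
So along the N08 count path the (α) clause may be read with the [B1] (3.24) input AS PRINTED and with the cumulants of the (3.24)∕G3D-02 rows in ANY currency the
supplier and the graph representation agree on — in particular the free-cumulant currency of [BenfattoEtAl1978] p. 152 ∕ of print's Wick graphs (23).
HONEST FRAMING.  Count-neutral kernel bookkeeping BY NAME; nothing of [B10] asserted or discharged (the rows ARE the cluster expansion = object gap); the IDENT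
of B10's step measures with a Gaussian model of the [2]-class (class II) untouched; N08 NOT discharged; one finite 𝕋⁴ programme at fixed ε, d = 3 tori inside
the record, Bałaban AS PRINTED; nothing continuum ∕ ℝ⁴ ∕ OS ∕ mass gap ∕ Clay — R4 closes the conditional finite-𝕋⁴ rung `BalabanLadder.UV` only.
-/

noncomputable section

namespace Summit.QuantumFields.YangMills.Theorems.BalabanUVNodesN08AlphaEq324RowCumLetterEnd

open MeasureTheory Metric
open scoped BigOperators Nat Matrix.Norms.L2Operator
open Literature.MathematicalPhysics.QuantumFieldTheory.Balaban1983to89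
open Literature.MathematicalPhysics.QuantumFieldTheory.Balaban1983to89.B10
open Literature.MathematicalPhysics.QuantumFieldTheory.Balaban1983to89.B10SectAGathering
open Literature.MathematicalPhysics.QuantumFieldTheory.Balaban1983to89.DagBinding
open Literature.MathematicalPhysics.QuantumFieldTheory.Balaban1983to89.DagDischargedII
open Literature.MathematicalPhysics.QuantumFieldTheory.Balaban1983to89.DagDischarged (b10Compact)
open Literature.MathematicalPhysics.QuantumFieldTheory.Balaban1983to89.B10CompactBinding (ofPrintedAllXPNC)
open Literature.MathematicalPhysics.QuantumFieldTheory.Balaban1983to89.TreeLengthTorus (tsys tcubeSys)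
open Literature.MathematicalPhysics.QuantumFieldTheory.Balaban1983to89.B1Sect3Statements (Eq324)
open Literature.MathematicalPhysics.QuantumFieldTheory.Balaban1985CMP102
open Literature.MathematicalPhysics.QuantumFieldTheory.Balaban1985CMP102.Setting
open Literature.MathematicalPhysics.QuantumFieldTheory.Balaban1985CMP102.Theorems
open Summit.QuantumFields.Balaban3D.Carriers
open Summit.QuantumFields.Balaban3D.Proofs
open Summit.QuantumFields.Balaban3D.Proofs.ScalesArithmetic
open Summit.QuantumFields.Balaban3D.Proofs.Constants
open Summit.QuantumFields.Balaban3D.Proofs.UVStability3D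
open Summit.QuantumFields.Balaban3D.Proofs.EndTheorem
open Summit.QuantumFields.Balaban3D.Proofs.Inputs
open Summit.QuantumFields.Balaban3D.Proofs.Residuals
open Summit.QuantumFields.Balaban3D.Proofs.Primitives
open Summit.QuantumFields.Balaban3D.Proofs.Family (small28 gk_le_gamma46 gk_le_gammaOO gk_le_gamma71 prov_hb₁ prov_hb₂)
open Summit.QuantumFields.Balaban3D.Proofs.FamilyLE (ScalesLE runsLE thresholds_of_le)
open Summit.QuantumFields.Balaban3D.Proofs.Newborn46 (newborn46_std)
open Summit.QuantumFields.Balaban3D.Proofs.Bound55Std (Fibre49 Fibre57Low hint_std hint47_std)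
open Summit.QuantumFields.Balaban3D.Proofs.GroupModelLieC (lieC)
open Summit.QuantumFields.Balaban3D.Proofs.UVStability3DInputs
open Summit.QuantumFields.YangMills.Theorems.BalabanUVNodesN08AlphaEq324RowRange (AlphaDataLT)
open Summit.QuantumFields.YangMills.Theorems.BalabanUVNodesN08AlphaEq324RowCumLetter
open Summit.QuantumFields.YangMills.Theorems.BalabanUVNodesN08ConstructedCoreLT
  (b10Compact_constructedLE_of_concreteLeaves b10_main_constructedLE_upC_of_concreteLeaves)

variable {L : ℕ}

/-! ## §1 The residual leaves from the re-lettered core clause -/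

section Reduce

variable {S : Scales L} {G : Type} [GaugeGroup G] [MeasurableSpace G] [HaarData G] {𝔊 : GroupModel G} {𝔠 : AlphaConsts L 𝔊.N}
  {X : ExternalInputs S G} {𝔖 : ∀ k, StepSeries S G ↥(lieC 𝔊) (nblkOf S 𝔠.lane.carrier k) k} {𝔄 : AlphaDataLT 𝔊 𝔠 X 𝔖}
  {c : ∀ k, Hist S.P (k + 1) → GaugeField S.P (k + 1) G → ℕ → ℝ}

/-- (25) at the chart centre over the re-lettered list. [cite: Balaban1985UV3, (25) p.262] -/
theorem bound25_vac_coreLTAt {k : ℕ} {hk : k + 1 ≤ S.K} (A : StepAlphaEq324CoreLTAt 𝔊 𝔠 X 𝔖 𝔄 c k hk) :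
    Bound25Printed ⟨(tsys 3 (nblkOf S 𝔠.lane.carrier k)).Dom, GaugeField S.P (k + 1) G, (tsys 3 (nblkOf S 𝔠.lane.carrier k)).dj,
      fun Y _ => ((𝔖 k).Ψ Y 0).re⟩ (S.gk k) 𝔠.κ 𝔠.C25 := by
  intro Y _
  have hρ : 0 < 𝔠.ρ := (A.chart Y).1
  exact (Complex.abs_re_le_norm _).trans ((A.chart Y).2.2 0 (mem_closedBall_self (by positivity)))

/-- **THE RESIDUAL STEP LEAVES FROM THE RE-LETTERED CORE STEP INPUTS, GIVEN THE (28)-SMALLNESS AND THE `γ_OO` THRESHOLD** — gen 0's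
`…RowRange.stepResiduals_of_coreLT_of_thresholds` with rows C3∕C4 supplied at the letter `c k` by `…RowCumLetter.cumulant58∕cumulantLower_pieces_of_eq324_at`.
[cite: Balaban1985UV3, (55)–(61) pp.269–271 + p.272] -/
theorem stepResiduals_of_coreLTAt_of_thresholds {k : ℕ} (hk : k + 1 ≤ S.K) (A : StepAlphaEq324CoreLTAt 𝔊 𝔠 X 𝔖 𝔄 c k hk)
    (hsmall : 𝔠.cB * (rFun 𝔠.r₀ (S.gk k) * S.gk k * pFun 𝔠.b₀ 𝔠.p₀ (S.gk k)) ≤ 𝔠.ρ / 4) (hOO : S.gk k ≤ 𝔠.gammaOO) :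
    StepResiduals 𝔠.lane X 𝔖 k := by
  haveI : RegularGaugeGroup G := groupModel_regularGaugeGroup 𝔊
  have hC₂ : 0 ≤ 𝔠.Ca + 0 + 𝔠.Cc := by simpa only [add_zero] using 𝔠.Cac_nonneg
  have h324' : ∀ h (U : GaugeField S.P (k + 1) G),
      Eq324 (∫ ω in (𝔖 k).box h, Real.exp ((𝔖 k).𝒱 h U ω) ∂(𝔖 k).μ) (c k h U) 𝔠.nbar (𝔠.Ca + 0 + 𝔠.Cc)
        ((L : ℝ) ^ k * S.g0sq) (3 + 𝔠.κ₀) (S.sites k) := fun h U => by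
    simpa only [add_zero] using A.h324 h U
  have h25 : ∀ h : Hist S.P (k + 1), Bound25Printed ⟨(tsys 3 (nblkOf S 𝔠.lane.carrier k)).Dom, GaugeField S.P (k + 1) G,
      (tsys 3 (nblkOf S 𝔠.lane.carrier k)).dj, (𝔖 k).act h⟩ (S.gk k) 𝔠.κ 𝔠.C25 := fun h =>
    ChartFromBound25.bound25_real_of_chart (T := towerOf 𝔠.lane X 𝔖) (k := k) (𝔖 k).Ψ A.chart (𝔖 k).Bcfg A.bound28 hsmall h
  exact
  { bound55 := AlphaBound55.bound55_pieces 𝔠.lane X 𝔖 k hk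
      (hint_std X 𝔠.lane.carrier 𝔖 (fun _ => True) k A.hU A.hPm (𝔄.cP k) A.hPb) A.fibre49
    bound55Lower := AlphaBound55.bound55Lower_pieces 𝔠.lane X 𝔖 k
      (hint47_std X 𝔠.lane.carrier 𝔖 (fun _ => True) k (A.hU _) (A.hPm _) (𝔄.cP k) (A.hPb _)) A.fibre57Low
    cumulant58 := cumulant58_pieces_of_eq324_at 𝔠.lane X 𝔖 k hk 𝔠.kappa_ge 𝔠.C25_nonneg 𝔠.one_le_r₀ 𝔠.R₁_ge hC₂ rfl rfl
      A.hact (c k) h324' A.hG h25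
    cumulantLower := cumulantLower_pieces_of_eq324_at 𝔠.lane X 𝔖 k hk 𝔠.kappa_ge 𝔠.C25_nonneg 𝔠.one_le_r₀ 𝔠.R₁_ge hC₂ rfl
      A.hact (c k) h324' A.hG h25
    repr33_60 := AlphaRepr.repr33_60_pieces 𝔠.lane X 𝔖 k hk 𝔠.chart (by linarith [𝔠.kappa_ge]) 𝔠.C25_nonneg 𝔠.C25_le
      𝔠.κ₀_lt_half rfl A.chart A.bound28 hsmall (adjAct 𝔊 (P := S.P) k) A.inv26
      (hdet_adjAct 𝔊 k) A.far_le A.hPY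
    vacuumWhole := AlphaRepr.vacuumWhole_pieces 𝔠.lane X 𝔖 k hk 𝔠.kappa_ge 𝔠.C25_nonneg 𝔠.one_le_r₀ 𝔠.R₁_ge rfl rfl A.chart
    decomp35_61 := AlphaRepr.decomp35_61_pieces 𝔠.lane X 𝔖 k hk 𝔠.chart rfl 𝔠.kappa_ge 𝔠.C63_nonneg 𝔠.C63_le 𝔠.one_le_r₀
      𝔠.κ₀_lt_half 𝔠.R₁_ge rfl A.bound28 hsmall (adjAct 𝔊 (P := S.P) k) (hdet_adjAct 𝔊 k)
      (𝔄.Λc k hk) A.hPYZ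
    norm35 := AlphaRepr.norm35_pieces 𝔠.lane X 𝔖 k 𝔠.c35_pos rfl A.norm35
    oldOutside := AlphaCumulant.oldOutside_pieces 𝔠.lane X 𝔖 k hk 𝔠.C44_nonneg 𝔠.B₃_pos.le 𝔠.κ₁_pos rfl A.h44 A.hfloor hOO }

/-- **THE RESIDUAL LEAVES OF THE RUN FROM THE RE-LETTERED CORE CLAUSE** on the exhibited family `S.ε₀ = ε₀(S.g)` (gen 0's `…RowRange.runResiduals_of_alphaEq324CoreLT`
with the step leaves above). [cite: Balaban1985UV3, (46) p.267 + (65) p.273 + pp.273–274] -/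
theorem runResiduals_of_alphaEq324CoreLTAt (hS : S.ε₀ = eps0Of 𝔠.gamma0 S.g) (R : RunAlphaEq324CoreLTAt 𝔊 𝔠 X 𝔖 𝔄 c) :
    RunResiduals 𝔠.lane X 𝔖 where
  steps k hk := stepResiduals_of_coreLTAt_of_thresholds hk (R.steps k hk) (small28 hS k (by omega)) (gk_le_gammaOO hS k (by omega))
  bound46 := AlphaLargeField.bound46_tower 𝔠.lane X 𝔖 𝔠.C44_nonneg 𝔠.Cnew_nonneg 𝔠.B₃_pos.le 𝔠.κ₁_pos rfl
    (fun k hk => (R.steps k hk).h44) (fun k hk => (R.steps k hk).hfloor) (fun k hk => gk_le_gamma46 hS k (by omega))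
    (fun k hk => newborn46_std X 𝔠.lane.carrier 𝔖 k (by omega) (by rw [P_m, P_K]; omega) 𝔠.chart (by linarith [𝔠.kappa_ge])
      𝔠.C25_nonneg 𝔠.C63_nonneg 𝔠.b₀_pos.le 𝔠.p₀_pos (lt_of_lt_of_le one_pos 𝔠.one_le_r₀) (R.steps k hk).chart
      (R.steps k hk).bound28 (small28 hS k (by omega)) (R.steps k hk).far_le (R.steps k hk).hPY (𝔄.Λc k hk) (𝔄.N45 k hk)
      (R.steps k hk).hPYZ)
  logZT_le k hk := AlphaRepr.logZT_le_pieces 𝔠.lane X 𝔖 k 𝔠.cT_pos rfl (R.steps k hk).logZT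
  PprT_le k hk := AlphaCumulant.pprT_le_pieces 𝔠.lane X 𝔖 k hk (by linarith [𝔠.kappa_ge]) 𝔠.C25_nonneg rfl
    (bound25_vac_coreLTAt (R.steps k hk))
  lf := AlphaLargeField.lf_tower 𝔠.lane X 𝔖 𝔊 𝔠.R₁_nonneg (le_trans zero_le_one 𝔠.one_le_r₀)
    (add_nonneg 𝔠.Cz_nonneg 𝔠.Cv_nonneg) 𝔠.C₅_nonneg 𝔠.C₆_nonneg 𝔠.C68_pos
    (fun j hj => gk_le_gamma71 hS j hj.le) R.hLF67 R.h68 𝔠.prov_r₀p₀ (prov_hb₁ 𝔠 𝔊.N_pos) (prov_hb₂ 𝔠 𝔊.N_pos)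

/-- **… and on the `≤`-family `S.g²·S.ε₀ ≤ (min γ₀ 1)²`** (lane `FamilyLE`). [cite: Balaban1985UV3, (46) p.267 + (65) p.273 + pp.273–274] -/
theorem runResiduals_of_alphaEq324CoreLTAt_le (hle : S.g ^ 2 * S.ε₀ ≤ (min 𝔠.gamma0 1) ^ 2) (R : RunAlphaEq324CoreLTAt 𝔊 𝔠 X 𝔖 𝔄 c) :
    RunResiduals 𝔠.lane X 𝔖 where
  steps k hk := stepResiduals_of_coreLTAt_of_thresholds hk (R.steps k hk) (thresholds_of_le hle k (by omega)).2.2.2.2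
    (thresholds_of_le hle k (by omega)).2.2.1
  bound46 := AlphaLargeField.bound46_tower 𝔠.lane X 𝔖 𝔠.C44_nonneg 𝔠.Cnew_nonneg 𝔠.B₃_pos.le 𝔠.κ₁_pos rfl
    (fun k hk => (R.steps k hk).h44) (fun k hk => (R.steps k hk).hfloor) (fun k hk => (thresholds_of_le hle k (by omega)).2.1)
    (fun k hk => newborn46_std X 𝔠.lane.carrier 𝔖 k (by omega) (by rw [P_m, P_K]; omega) 𝔠.chart (by linarith [𝔠.kappa_ge])
      𝔠.C25_nonneg 𝔠.C63_nonneg 𝔠.b₀_pos.le 𝔠.p₀_pos (lt_of_lt_of_le one_pos 𝔠.one_le_r₀) (R.steps k hk).chart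
      (R.steps k hk).bound28 (thresholds_of_le hle k (by omega)).2.2.2.2 (R.steps k hk).far_le (R.steps k hk).hPY (𝔄.Λc k hk) (𝔄.N45 k hk)
      (R.steps k hk).hPYZ)
  logZT_le k hk := AlphaRepr.logZT_le_pieces 𝔠.lane X 𝔖 k 𝔠.cT_pos rfl (R.steps k hk).logZT
  PprT_le k hk := AlphaCumulant.pprT_le_pieces 𝔠.lane X 𝔖 k hk (by linarith [𝔠.kappa_ge]) 𝔠.C25_nonneg rfl
    (bound25_vac_coreLTAt (R.steps k hk))
  lf := AlphaLargeField.lf_tower 𝔠.lane X 𝔖 𝔊 𝔠.R₁_nonneg (le_trans zero_le_one 𝔠.one_le_r₀)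
    (add_nonneg 𝔠.Cz_nonneg 𝔠.Cv_nonneg) 𝔠.C₅_nonneg 𝔠.C₆_nonneg 𝔠.C68_pos
    (fun j hj => (thresholds_of_le hle j hj.le).2.2.2.1) R.hLF67 R.h68 𝔠.prov_r₀p₀ (prov_hb₁ 𝔠 𝔊.N_pos) (prov_hb₂ 𝔠 𝔊.N_pos)

end Reduce

/-! ## §2 THE END THEOREMS from the re-lettered clause, for every letter -/

section End

/-- ★ **BAŁABAN CMP 102 THEOREM 1 (compact reading) ∧ THEOREM 2 FROM THE (α) CLAUSE AT AN ARBITRARY CUMULANT LETTER** — the lane's `uvStability3D_of_inputs`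
with `AlphaData ↦ AlphaDataLT` and `RunAlpha ↦ RunAlphaEq324CoreLTAt … (c G 𝔊 S)`, the (3.24)∕G3D-02 rows reading any cumulant function `c G 𝔊 S k h U` (e.g. the
free Gaussian moment-cumulants of the [2]-road). [cite: Balaban1985UV3, Thm 1 p.257 + Thm 2 p.272 + p.256 L15–18] -/
theorem uvStability3D_of_inputsEq324CoreLTAt
    (𝔠 : ∀ (G : Type) [GaugeGroup G] [MeasurableSpace G] [HaarData G] (𝔊 : GroupModel G), AlphaConsts L 𝔊.N)
    (X : ∀ (G : Type) [GaugeGroup G] [MeasurableSpace G] [HaarData G], GroupModel G → ∀ S : Scales L, ExternalInputs S G)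
    (𝔖 : ∀ (G : Type) [GaugeGroup G] [MeasurableSpace G] [HaarData G] (𝔊 : GroupModel G) (S : Scales L) (k : ℕ),
      StepSeries S G ↥(lieC 𝔊) (nblkOf S (𝔠 G 𝔊).lane.carrier k) k)
    (𝔄 : ∀ (G : Type) [GaugeGroup G] [MeasurableSpace G] [HaarData G] (𝔊 : GroupModel G) (S : Scales L),
      AlphaDataLT 𝔊 (𝔠 G 𝔊) (X G 𝔊 S) (𝔖 G 𝔊 S))
    (c : ∀ (G : Type) [GaugeGroup G] [MeasurableSpace G] [HaarData G] (𝔊 : GroupModel G) (S : Scales L) (k : ℕ),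
      Hist S.P (k + 1) → GaugeField S.P (k + 1) G → ℕ → ℝ)
    (hα : ∀ (G : Type) [GaugeGroup G] [MeasurableSpace G] [HaarData G] (𝔊 : GroupModel G) (S : Scales L),
      S.ε₀ = eps0Of (𝔠 G 𝔊).gamma0 S.g → RunAlphaEq324CoreLTAt 𝔊 (𝔠 G 𝔊) (X G 𝔊 S) (𝔖 G 𝔊 S) (𝔄 G 𝔊 S) (c G 𝔊 S)) :
    Thm1AsPrintedCompact (laneT 𝔠 X 𝔖).toConstruction ∧ Thm2AsPrintedC (laneT 𝔠 X 𝔖).toConstruction :=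
  uvStability3D_of_residuals (fun G _ _ _ 𝔊 => (𝔠 G 𝔊).lane) (fun G _ _ _ 𝔊 => (𝔠 G 𝔊).gamma0)
    (fun G _ _ _ 𝔊 => (𝔠 G 𝔊).gamma0_pos) (fun _ _ _ _ 𝔊 => lieChart 𝔊) X 𝔖
    (fun G _ _ _ 𝔊 S hS => runResiduals_of_alphaEq324CoreLTAt hS (hα G 𝔊 S hS))

/-- ★ **… AND ON THE `≤`-FAMILY** (`FamilyLE.uvStability3D_of_inputs_le` over the re-lettered clause). [cite: Balaban1985UV3, Thm 1 p.257 + Thm 2 p.272 + p.256 L15–18] -/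
theorem uvStability3D_of_inputsEq324CoreLTAt_le
    (𝔠 : ∀ (G : Type) [GaugeGroup G] [MeasurableSpace G] [HaarData G] (𝔊 : GroupModel G), AlphaConsts L 𝔊.N)
    (X : ∀ (G : Type) [GaugeGroup G] [MeasurableSpace G] [HaarData G], GroupModel G → ∀ S : Scales L, ExternalInputs S G)
    (𝔖 : ∀ (G : Type) [GaugeGroup G] [MeasurableSpace G] [HaarData G] (𝔊 : GroupModel G) (S : Scales L) (k : ℕ),
      StepSeries S G ↥(lieC 𝔊) (nblkOf S (𝔠 G 𝔊).lane.carrier k) k)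
    (𝔄 : ∀ (G : Type) [GaugeGroup G] [MeasurableSpace G] [HaarData G] (𝔊 : GroupModel G) (S : Scales L),
      AlphaDataLT 𝔊 (𝔠 G 𝔊) (X G 𝔊 S) (𝔖 G 𝔊 S))
    (G : Type) [GaugeGroup G] [MeasurableSpace G] [HaarData G] (𝔊 : GroupModel G)
    (c : ∀ (S : Scales L) (k : ℕ), Hist S.P (k + 1) → GaugeField S.P (k + 1) G → ℕ → ℝ)
    (hα : ∀ S : Scales L, S.g ^ 2 * S.ε₀ ≤ (min (𝔠 G 𝔊).gamma0 1) ^ 2 →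
      RunAlphaEq324CoreLTAt 𝔊 (𝔠 G 𝔊) (X G 𝔊 S) (𝔖 G 𝔊 S) (𝔄 G 𝔊 S) (c S)) :
    Thm1PrintedCompact (runsLE (laneT 𝔠 X 𝔖).toConstruction G 𝔊 ((min (𝔠 G 𝔊).gamma0 1) ^ 2)) ∧
      Thm2Printed (runsLE (laneT 𝔠 X 𝔖).toConstruction G 𝔊 ((min (𝔠 G 𝔊).gamma0 1) ^ 2)) :=
  uvStability3D_compact_subfamily (laneT 𝔠 X 𝔖).toConstruction (𝔠 G 𝔊).lane.consts (𝔠 G 𝔊).lane.normalised (laneT 𝔠 X 𝔖).tower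
    (fun G _ _ _ 𝔊 S => (laneT 𝔠 X 𝔖).tower_toRunData G 𝔊 S) (fun S : ScalesLE L ((min (𝔠 G 𝔊).gamma0 1) ^ 2) => S.1) G 𝔊
    (fun S => { toCarrierEqs := carrierEqs_pin _ (usesConsts_inputOf (𝔠 G 𝔊).lane (X G 𝔊 S.1) (𝔖 G 𝔊 S.1) fun _ => True),
                toAnalyticLeaves := analyticLeavesOf (runResiduals_of_alphaEq324CoreLTAt_le S.2 (hα S.1 S.2)) })

end End

/-! ## §3 N08 BY NAME at the C-binding of record over the constructed run family, from the re-lettered clause -/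

section ByName

variable {G : Type} [GaugeGroup G] [MeasurableSpace G] [HaarData G] {𝔊 : GroupModel G} {𝔠 : AlphaConsts L 𝔊.N}
  {X : ∀ S : Scales L, ExternalInputs S G}
  {𝔖 : ∀ (S : Scales L) (k : ℕ), StepSeries S G ↥(lieC 𝔊) (nblkOf S 𝔠.lane.carrier k) k}
  {𝔄 : ∀ S : Scales L, AlphaDataLT 𝔊 𝔠 (X S) (𝔖 S)}
  {c : ∀ (S : Scales L) (k : ℕ), Hist S.P (k + 1) → GaugeField S.P (k + 1) G → ℕ → ℝ}
  {Xc : PrintedCarriersR} {Y : PrintedCarriers9X} {Z : PrintedCarriers11} {V : PrintedCarriers14R} {W : PrintedCarriers15}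
  {w : WorldP} {P : B12.RunParams}

/-- **THE CONSTRUCTED TOWER CARRIES THE CONCRETE LEAF BUNDLE, given the re-lettered core clause** on the `≤`-family (gen 0's
`…N08ConstructedCoreLT.nonempty_concreteLeaves_of_coreLT_le` with `RunAlphaEq324CoreLT ↦ RunAlphaEq324CoreLTAt … (c S)`). [cite: Balaban1985UV3, pp.256–274 + Thm 1 p.257 + Thm 2 p.272] -/
theorem nonempty_concreteLeaves_of_coreLTAt_le (S : Scales L) (hle : S.g ^ 2 * S.ε₀ ≤ (min 𝔠.gamma0 1) ^ 2)
    (R : RunAlphaEq324CoreLTAt 𝔊 𝔠 (X S) (𝔖 S) (𝔄 S) (c S)) : Nonempty (ConcreteLeaves 𝔠.lane.consts S (towerOf 𝔠.lane (X S) (𝔖 S))) :=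
  ⟨{ toCarrierEqs := carrierEqs_pin _ (usesConsts_inputOf 𝔠.lane (X S) (𝔖 S) fun _ => True)
     toAnalyticLeaves := analyticLeavesOf (runResiduals_of_alphaEq324CoreLTAt_le hle R) }⟩

/-- ★ **N08 BY NAME AT THE C-BINDING OF RECORD FROM THE (α) CLAUSE AT AN ARBITRARY CUMULANT LETTER** on `ScalesLE L ((min γ₀ 1)²)`:
`Dag.B10_main (leavesP w P) ∧ b10Compact (…)` — gen 0's abstracted closers fed with the bundles of `nonempty_concreteLeaves_of_coreLTAt_le`.
[cite: Balaban1985UV3, Thm 1 p.257 (compact reading) + Thm 2 p.272] -/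
theorem b10_main_of_coreLTAt_upC
    (hα : ∀ S : Scales L, S.g ^ 2 * S.ε₀ ≤ (min 𝔠.gamma0 1) ^ 2 → RunAlphaEq324CoreLTAt 𝔊 𝔠 (X S) (𝔖 S) (𝔄 S) (c S))
    (hup : w.up P = ofPrintedAllXPNC (Xc.withTowerRuns10 fun S : ScalesLE L ((min 𝔠.gamma0 1) ^ 2) =>
      towerOf 𝔠.lane (X S.1) (𝔖 S.1)) Y Z V W) :
    Dag.B10_main (leavesP w P) ∧
      b10Compact (Xc.withTowerRuns10 fun S : ScalesLE L ((min 𝔠.gamma0 1) ^ 2) => towerOf 𝔠.lane (X S.1) (𝔖 S.1)).toPrintedCarriers :=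
  ⟨b10_main_constructedLE_upC_of_concreteLeaves (fun S => nonempty_concreteLeaves_of_coreLTAt_le S.1 S.2 (hα S.1 S.2)) hup,
    b10Compact_constructedLE_of_concreteLeaves (fun S => nonempty_concreteLeaves_of_coreLTAt_le S.1 S.2 (hα S.1 S.2)) Xc⟩

end ByName

end Summit.QuantumFields.YangMills.Theorems.BalabanUVNodesN08AlphaEq324RowCumLetterEnd

end
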